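import Summits.Ventures.HodgeRepro2.T5SU11JacobiKPartLaw

/-!
# The explicit model in measure form: `(orbit, kProj)_* P_{k,λ} = (orbit_* P_{k,λ}) ⊗ dk` — the law of the orbit point
times the Haar measure of `K`

`T5SU11JacobiKPartLaw` states the independence of the `K`-component from the orbit point through integrals of products.
Here it is stated for the MEASURES: with `P_{k,λ} := ν.withDensity (m_k φ_λ)` (the Jacobi density on `G`, not
normalised — normalisation is a scalar) and the pushforward lemma **`map T (μ.withDensity (g ∘ T)) = (map T μ).withDensity g`**
(`map_withDensity_comp`, for measurable `T`, `g`), the density `m_k φ_λ = F_{k,λ} ∘ orbit` with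
`F_{k,λ}(z) = (1 − |z|²)^{k/2} φ_λ(s(z))` (`jacobi_density_eq_orbit`) gives

  **`(g ↦ (g·0, kProj g))_* P_{k,λ} = (poincare.withDensity F_{k,λ}) ⊗ dk`**   (`map_orbit_kProj_jacobi`),
  **`orbit_* P_{k,λ} = poincare.withDensity F_{k,λ}`**   (`map_orbit_jacobi`: the law of the orbit point is the area density
  `F_{k,λ}` on the disc — in polar form the radial density of `T5SU11JacobiOrbitDiscLaw`),
  **`kProj_* P_{k,λ} = m̂_k(λ) · dk`**   (`map_kProj_jacobi`: the `K`-component is Haar-distributed, with the total mass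
  `m̂_k(λ) = ∫_𝔻 F_{k,λ} dpoincare` of the model),

so the joint law of the pair is the product of its marginals: independence in the strongest (measure) form, for every
`(k, λ)` (on the ray the masses are finite and positive). Nothing is claimed about (N).

Blind lane: Mathlib + the HodgeRepro2 prefix only; no sorry; axioms ⊆ {propext, Classical.choice,
Quot.sound}.
-/

namespace Summit.Ventures.HodgeRepro2.T5SU11JacobiKPartMeasure

open MeasureTheory MeasureTheory.Measure Metric Set Filter Topology Complex
open T5PoincareDensity T5PoincareMeasure T5SU11Unimodular T5SU11Fibration T5SU11FibrationHaar T5SU11Cartan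
  T5HaarCircle T5BergmanCoefficient T5SU11KProjection T5SU11OrbitMeasure T5SU11SphericalFunction
  T5SU11SphericalContinuous T5SU11JacobiWeight T5SU11KFiniteMajorantPow T5SU11JacobiKPartLaw
open scoped ENNReal Real

/-! ### Pushing forward a density that factors through the map -/

/-- **`map T (μ.withDensity (g ∘ T)) = (map T μ).withDensity g`** for measurable `T`, `g`. -/
theorem map_withDensity_comp {α β : Type*} [MeasurableSpace α] [MeasurableSpace β] (μ : Measure α) {T : α → β}
    (hT : Measurable T) {g : β → ℝ≥0∞} (hg : Measurable g) :
    Measure.map T (μ.withDensity (fun a => g (T a))) = (Measure.map T μ).withDensity g := by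
  ext s hs
  rw [Measure.map_apply hT hs, withDensity_apply _ (hT hs), withDensity_apply _ hs, setLIntegral_map hs hg hT]

section measure

variable [MeasurableSpace Circle] [BorelSpace Circle]

/-- The Jacobi density on the disc, as an `ℝ≥0∞`-valued density: `F_{k,λ}(z) = (1 − |z|²)^{k/2} φ_λ(s(z))`. -/
noncomputable def jacobiDiscDensity (k lam : ℝ) : ℂ → ℝ≥0∞ :=
  fun z => ENNReal.ofReal ((1 - ‖z‖ ^ 2) ^ (k / 2) * sph lam (sec z))

/-- `F_{k,λ}` is measurable. -/
theorem measurable_jacobiDiscDensity (k lam : ℝ) : Measurable (jacobiDiscDensity k lam) :=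
  ENNReal.measurable_ofReal.comp (measurable_jacobi_disc_density k lam)

omit [BorelSpace Circle] in
/-- The Jacobi measure on `G`, `P_{k,λ} = ν.withDensity (m_k φ_λ)`, has density `F_{k,λ} ∘ orbit`. -/
theorem jacobi_measure_eq (k lam : ℝ) :
    (nu haarCircle).withDensity (fun g => ENNReal.ofReal ((1 - ‖orbit g‖ ^ 2) ^ (k / 2) * sph lam g))
      = (nu haarCircle).withDensity (fun g => jacobiDiscDensity k lam (orbit g)) := by
  congr 1
  funext g
  rw [jacobiDiscDensity, jacobi_density_eq_orbit]

/-- **THE JOINT LAW OF THE ORBIT POINT AND THE `K`-COMPONENT IS A PRODUCT**: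
`(g ↦ (g·0, kProj g))_* P_{k,λ} = (poincare.withDensity F_{k,λ}) ⊗ dk`. -/
theorem map_orbit_kProj_jacobi (k lam : ℝ) :
    Measure.map (fun g : SU11 => (orbit g, kProj g))
        ((nu haarCircle).withDensity (fun g => ENNReal.ofReal ((1 - ‖orbit g‖ ^ 2) ^ (k / 2) * sph lam g)))
      = (poincare.withDensity (jacobiDiscDensity k lam)).prod haarCircle := by
  have hT : Measurable (fun g : SU11 => (orbit g, kProj g)) := continuous_orbit.measurable.prodMk measurable_kProj
  have hg : Measurable (fun p : ℂ × Circle => jacobiDiscDensity k lam p.1) :=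
    (measurable_jacobiDiscDensity k lam).comp measurable_fst
  have h := map_withDensity_comp (nu haarCircle) hT hg
  simp only at h
  rw [jacobi_measure_eq, h, map_orbit_kProj_nu, prod_withDensity_left (measurable_jacobiDiscDensity k lam)]

/-- **The law of the orbit point**: `orbit_* P_{k,λ} = poincare.withDensity F_{k,λ}`. -/
theorem map_orbit_jacobi (k lam : ℝ) :
    Measure.map orbit
        ((nu haarCircle).withDensity (fun g => ENNReal.ofReal ((1 - ‖orbit g‖ ^ 2) ^ (k / 2) * sph lam g)))
      = poincare.withDensity (jacobiDiscDensity k lam) := by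
  have h := congrArg (Measure.map Prod.fst) (map_orbit_kProj_jacobi k lam)
  rw [Measure.map_map measurable_fst (continuous_orbit.measurable.prodMk measurable_kProj),
    Measure.map_fst_prod, haarCircle_univ, one_smul] at h
  exact h

/-- **The law of the `K`-component**: `kProj_* P_{k,λ} = (poincare.withDensity F_{k,λ}) univ • dk` — the Haar measure of `K`
scaled by the total mass of the model. -/
theorem map_kProj_jacobi (k lam : ℝ) :
    Measure.map kProj
        ((nu haarCircle).withDensity (fun g => ENNReal.ofReal ((1 - ‖orbit g‖ ^ 2) ^ (k / 2) * sph lam g)))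
      = (poincare.withDensity (jacobiDiscDensity k lam)) Set.univ • haarCircle := by
  have h := congrArg (Measure.map Prod.snd) (map_orbit_kProj_jacobi k lam)
  rw [Measure.map_map measurable_snd (continuous_orbit.measurable.prodMk measurable_kProj),
    Measure.map_snd_prod] at h
  exact h

end measure

end Summit.Ventures.HodgeRepro2.T5SU11JacobiKPartMeasure
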